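import Literature.Probability.Process.BrownianMotionProofs
import Literature.Probability.Process.KolmogorovExtensionProofs
import HarnessLib

/-!
# Planar (complex) Brownian motion: discharge of `Literature.Probability.Process.exists_isBrownianComplex`

This file proves (sorry-free) the named fact `Literature.Probability.Process.exists_isBrownianComplex` of
`Literature.Probability.Process.BrownianMotion`: on the product of two copies of the canonical
space `(ℝ≥0 → ℝ, preWienerMeasure)`, the process
`Z t (ω₁, ω₂) := brownian t ω₁ + i • brownian t ω₂` is a planar (complex) Brownian motion
(`Literature.Probability.Process.IsBrownianComplex`: real and imaginary parts are real Brownian motions, independent as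
path-valued random variables) with measurable marginals, everywhere continuous paths and
`Z 0 = 0`.

The proof assembles results already proved in `Literature`:

* the Kolmogorov extension theorem `Literature.Probability.Process.exists_isProjectiveLimit_holds`
  (`KolmogorovExtensionProofs`), giving `isProjectiveLimit_preWienerMeasure` and hence that the
  pre-Wiener measure is a probability measure;
* the continuous-modification theorem
  `ProbabilityTheory.IsPreBrownianReal.exists_modification_isBrownianReal_holds`
  (`BrownianMotionProofs`, Kolmogorov–Chentsov), giving
  `exists_isBrownianReal_measurable_continuous` and hence that `Literature.Probability.Process.brownian` is a Brownian
  motion under the pre-Wiener measure;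

with two transport lemmas proved here (`IsPreBrownianReal.comp_measurePreserving`,
`IsBrownianReal.comp_measurePreserving`: a (pre-)Brownian motion composed with a
measure-preserving map is a (pre-)Brownian motion), Mathlib's `measurePreserving_fst` /
`measurePreserving_snd` (projections of a product of probability measures) and Mathlib's
`indepFun_prod` (the two coordinates of a product measure are independent — Kallenberg,
Lemma 3.10).

## References

* O. Kallenberg, *Foundations of Modern Probability* (2nd ed., 2002), Thm 13.5 (existence of
  Brownian motion, Wiener) and the definition of Brownian motion in `ℝ^d` following it
  ("`B¹, …, B^d` independent one-dimensional Brownian motions"); Lemma 3.10 (product measures: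
  `ξ₁, …, ξₙ` are independent iff `(ξ₁, …, ξₙ)` has distribution `μ₁ ⊗ ⋯ ⊗ μₙ`); Lemma 1.22
  (image measures).
* N. Wiener, *Differential space*, J. Math. and Phys. 2 (1923), 131–174.
-/

open MeasureTheory ProbabilityTheory
open scoped NNReal

namespace ProbabilityTheory

/-! ### Transport of (pre-)Brownian motions along measure-preserving maps -/

section Transport

variable {Ω Ω' : Type*} {mΩ : MeasurableSpace Ω} {mΩ' : MeasurableSpace Ω'}
  {X : ℝ≥0 → Ω → ℝ} {P : Measure Ω} {P' : Measure Ω'} {f : Ω' → Ω}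

/-- A pre-Brownian motion `X` on `(Ω, P)` composed with a measure-preserving map
`f : (Ω', P') → (Ω, P)` is a pre-Brownian motion on `(Ω', P')`: its finite-dimensional laws are
the image laws `P' ∘ (X_I ∘ f)⁻¹ = P ∘ X_I⁻¹`. Dot-notation extension declared in Mathlib's
namespace `ProbabilityTheory.IsPreBrownianReal`. Kallenberg, *Foundations of Modern
Probability* (2002), Lemma 1.22 (image measures) and Ch. 13. [folklore] -/
theorem IsPreBrownianReal.comp_measurePreserving (hX : IsPreBrownianReal X P)
    (hf : MeasurePreserving f P' P) : IsPreBrownianReal (fun t ω ↦ X t (f ω)) P' where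
  hasLaw I := (hX.hasLaw I).fun_comp hf.hasLaw

/-- A Brownian motion `X` on `(Ω, P)` composed with a measure-preserving map
`f : (Ω', P') → (Ω, P)` is a Brownian motion on `(Ω', P')` (laws by
`IsPreBrownianReal.comp_measurePreserving`; a.s. path continuity pulls back along `f` since
`P = P' ∘ f⁻¹`). Dot-notation extension declared in Mathlib's namespace
`ProbabilityTheory.IsBrownianReal`. Kallenberg, *Foundations of Modern Probability* (2002),
Lemma 1.22 and Ch. 13. [folklore] -/
theorem IsBrownianReal.comp_measurePreserving (hX : IsBrownianReal X P)
    (hf : MeasurePreserving f P' P) : IsBrownianReal (fun t ω ↦ X t (f ω)) P' where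
  toIsPreBrownianReal := hX.toIsPreBrownianReal.comp_measurePreserving hf
  cont := by
    have h := hX.cont
    rw [← hf.map_eq] at h
    exact ae_of_ae_map hf.measurable.aemeasurable h

end Transport

end ProbabilityTheory

namespace Literature.Probability.Process

/-! ### Planar (complex) Brownian motion -/

/-- A complex-valued map with measurable real and imaginary parts is measurable
(`⟨f, g⟩ = f + g • i`). [folklore] -/
theorem measurable_complexMk {α : Type*} [MeasurableSpace α] {f g : α → ℝ} (hf : Measurable f)
    (hg : Measurable g) : Measurable fun a ↦ (⟨f a, g a⟩ : ℂ) := by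
  have h : (fun a ↦ (⟨f a, g a⟩ : ℂ)) = fun a ↦ (f a : ℂ) + g a * Complex.I :=
    funext fun a ↦ Complex.mk_eq_add_mul_I _ _
  rw [h]
  exact hf.complex_ofReal.add (hg.complex_ofReal.mul_const _)

/-- A complex-valued map with continuous real and imaginary parts is continuous
(`⟨f, g⟩ = f + g • i`). [folklore] -/
theorem continuous_complexMk {α : Type*} [TopologicalSpace α] {f g : α → ℝ} (hf : Continuous f)
    (hg : Continuous g) : Continuous fun a ↦ (⟨f a, g a⟩ : ℂ) := by
  have h : (fun a ↦ (⟨f a, g a⟩ : ℂ)) = fun a ↦ (f a : ℂ) + g a * Complex.I :=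
    funext fun a ↦ Complex.mk_eq_add_mul_I _ _
  rw [h]
  exact (Complex.continuous_ofReal.comp hf).add
    ((Complex.continuous_ofReal.comp hg).mul continuous_const)

/-- **Existence of planar Brownian motion**: discharge of the named fact
`Literature.Probability.Process.exists_isBrownianComplex`. On the product `(ℝ≥0 → ℝ) × (ℝ≥0 → ℝ)` of two copies of the
canonical space, with the product `preWienerMeasure.prod preWienerMeasure` of pre-Wiener
measures, `Z t (ω₁, ω₂) := brownian t ω₁ + i • brownian t ω₂` is a complex Brownian motion with
measurable marginals, everywhere continuous paths and `Z 0 = 0`.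
Proof: the pre-Wiener measure is a probability measure and `brownian` is a Brownian motion under
it, unconditionally (Kolmogorov extension `exists_isProjectiveLimit_holds` and Kolmogorov–Chentsov
`IsPreBrownianReal.exists_modification_isBrownianReal_holds`, fed into
`isProjectiveLimit_preWienerMeasure_of` / `exists_isBrownianReal_measurable_continuous_of`);
both projections of the product of two probability measures are measure preserving (Mathlib
`measurePreserving_fst` / `measurePreserving_snd`), so the real and imaginary parts are Brownian
motions (`IsBrownianReal.comp_measurePreserving`); and the two coordinates of a product measure
are independent (Kallenberg 2002, Lemma 3.10; Mathlib `indepFun_prod`), hence so are the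
path-valued random variables `ω ↦ brownian · ω₁` and `ω ↦ brownian · ω₂`. Kallenberg,
*Foundations of Modern Probability* (2nd ed., 2002), Thm 13.5 (existence of Brownian motion,
Wiener) with the definition of Brownian motion in `ℝ^d` following it ("`B¹, …, B^d` independent
one-dimensional Brownian motions"), and Lemma 3.10 (product measures).
[cite: Kallenberg2002, Thm 13.5 and Lemma 3.10] -/
theorem exists_isBrownianComplex_holds : exists_isBrownianComplex := by
  have hW : isProjectiveLimit_preWienerMeasure :=
    isProjectiveLimit_preWienerMeasure_of exists_isProjectiveLimit_holds
  haveI : IsProbabilityMeasure preWienerMeasure := isProbabilityMeasure_preWienerMeasure hW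
  have hB : IsBrownianReal brownian preWienerMeasure :=
    isBrownianReal_brownian (exists_isBrownianReal_measurable_continuous_of hW
      IsPreBrownianReal.exists_modification_isBrownianReal_holds)
  have hpath : Measurable fun (ω : ℝ≥0 → ℝ) (t : ℝ≥0) ↦ brownian t ω :=
    measurable_pi_lambda _ measurable_brownian
  refine ⟨fun t ω ↦ ⟨brownian t ω.1, brownian t ω.2⟩, ⟨?_, ?_, ?_⟩, fun t ↦ ?_, fun ω ↦ ?_,
    fun ω ↦ ?_⟩
  · exact hB.comp_measurePreserving measurePreserving_fst
  · exact hB.comp_measurePreserving measurePreserving_snd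
  · exact indepFun_prod hpath hpath
  · exact measurable_complexMk ((measurable_brownian t).comp measurable_fst)
      ((measurable_brownian t).comp measurable_snd)
  · exact continuous_complexMk (continuous_brownian ω.1) (continuous_brownian ω.2)
  · exact Complex.ext (congrFun brownian_zero ω.1) (congrFun brownian_zero ω.2)

end Literature.Probability.Process
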